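import Mathlib.NumberTheory.ArithmeticFunction.Misc
import Mathlib.NumberTheory.EulerProduct.Basic
import Mathlib.NumberTheory.ZetaValues
import Mathlib.Analysis.SpecificLimits.Basic
import HarnessLib

/-!
# The mean value of a multiplicative function which is `σ₁` at almost all primes

An elementary (Tauberian-free) substitute for the residue computation of Eichler's zeta function
of a quaternion order (Voight, *Quaternion Algebras*, GTM 288, §25.2–25.4 and §26.4: the zeta
function `ζ_O(s) = ∑_{I ⊆ O} N(I)^{-2s}` of an order factors as `ζ(2s) ζ(2s-1)` times finitely
many local factors, (25.3.7), and the class number / mass formula is read off from the residue at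
`s = 1`, Cor. 26.4.11, Thm. 26.5.3; Vignéras, *Arithmétique des algèbres de quaternions*,
LNM 800, V §2).  We isolate the purely arithmetic statement that is needed:

* `tendsto_sum_div_sq_of_multiplicative`: if `a : ℕ → ℕ` is multiplicative, `a(p^k) = σ₁(p^k)`
  for all primes `p` outside a finite set `S`, and `∑_k a(p^k) p^{-2k} = A_p` for `p ∈ S`, then
  `X⁻² ∑_{n ≤ X} a(n) → (π²/12) ∏_{p ∈ S} (1 - p⁻²)(1 - p⁻¹) A_p`.

The proof is the classical one for `∑_{n ≤ X} σ₁(n) ∼ (π²/12) X²`: write `a = g ⋆ id`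
(Dirichlet convolution) with `g` multiplicative, `g(p^k) = a(p^k) - p a(p^{k-1})`
(`arithG`, `arithG_mul_id_eq`), so that `∑_{n ≤ X} a(n) = ∑_{d ≤ X} g(d) T(⌊X/d⌋)` with
`T(y) = ∑_{j ≤ y} j = y²/2 + O(y)` (`sum_eq_sum_arithG_mul_triangular`,
`abs_sum_Icc_div_sub_sq_le`); the error term is `o(X²)` by a Kronecker-type lemma
(`tendsto_sum_mul_div_atTop_zero`) once `∑ |g(d)|/d² < ∞`, and the main term is
`(X²/2) ∑_d g(d)/d²`, evaluated by the Euler product (`Mathlib.NumberTheory.EulerProduct.Basic`)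
and `ζ(2) = π²/6` (`hasSum_zeta_two`): the local factor is `(1 - p⁻²)⁻¹` at good primes and
`(1 - p⁻¹) A_p` at `p ∈ S` (`summable_and_tsum_arithG_div_sq`).

All statements here are [folklore]; they are used in the proof of the Eichler mass formula
`Literature.NumberTheory.Automorphic.brandtModule_massFormula`.
-/

noncomputable section

open Filter Finset Real
open scoped Topology BigOperators

namespace Literature.NumberTheory.Automorphic

/-! ### Triangular numbers: `∑_{j ≤ ⌊y⌋} j = y²/2 + O(y)` -/

section Triangular

/-- `∑_{j=1}^{m} j = m (m + 1) / 2` over `ℝ`. [folklore] -/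
theorem sum_Icc_one_cast_eq (m : ℕ) : ∑ j ∈ Icc 1 m, (j : ℝ) = (m : ℝ) * (m + 1) / 2 := by
  induction m with
  | zero => simp
  | succ m ih =>
    rw [Finset.sum_Icc_succ_top (Nat.succ_le_succ (Nat.zero_le m)) , ih]
    push_cast
    ring

/-- **`|∑_{j ≤ X/d} j - (X/d)²/2| ≤ X/d`** (`X/d` the integer part on the left, the real quotient on
the right). [folklore] -/
theorem abs_sum_Icc_div_sub_sq_le (X d : ℕ) (hd : 0 < d) :
    |∑ j ∈ Icc 1 (X / d), (j : ℝ) - ((X : ℝ) / d) ^ 2 / 2| ≤ (X : ℝ) / d := by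
  rw [sum_Icc_one_cast_eq]
  set m := X / d with hm
  set y : ℝ := (X : ℝ) / d with hy
  have hdR : (0 : ℝ) < d := by exact_mod_cast hd
  -- `m ≤ y < m + 1`
  have h1 : (m : ℝ) ≤ y := by
    rw [hy, le_div_iff₀ hdR]; exact_mod_cast Nat.div_mul_le_self X d
  have h2 : y < m + 1 := by
    rw [hy, div_lt_iff₀ hdR]
    have h' : (X : ℝ) < ((X / d : ℕ) : ℝ) * d + d := by exact_mod_cast Nat.lt_div_mul_add (a := X) hd
    calc (X : ℝ) < ((X / d : ℕ) : ℝ) * d + d := h'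
      _ = ((m : ℝ) + 1) * d := by rw [hm]; ring
  have hm0 : (0 : ℝ) ≤ m := Nat.cast_nonneg m
  rw [abs_le]
  constructor <;> nlinarith [h1, h2, hm0]

end Triangular

/-! ### A Kronecker-type lemma: `(1/X) ∑_{d ≤ X} d |c_d| → 0` when `∑ |c_d| < ∞` -/

section Kronecker

/-- If `∑_d |c d|` converges then `(1/X) ∑_{d ≤ X} d |c d| → 0`. [folklore] -/
theorem tendsto_sum_mul_div_atTop_zero {c : ℕ → ℝ} (hc : Summable fun d => |c d|) :
    Tendsto (fun X : ℕ => (∑ d ∈ Icc 1 X, (d : ℝ) * |c d|) / X) atTop (𝓝 0) := by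
  rw [Metric.tendsto_atTop]
  intro ε hε
  -- tail: `∑_{d ∈ t} |c d| < ε / 2` for finite `t` beyond `D`
  obtain ⟨s, hs⟩ := summable_iff_vanishing_norm.mp hc (ε / 2) (half_pos hε)
  set D := s.sup id with hDdef
  have hD : ∀ t : Finset ℕ, (∀ d ∈ t, D < d) → ∑ d ∈ t, |c d| < ε / 2 := fun t ht => by
    have h := hs t (Finset.disjoint_left.mpr fun d hd hds => by
      have : d ≤ D := Finset.le_sup (f := id) hds
      exact absurd (ht d hd) (not_lt.mpr this))
    rw [Real.norm_eq_abs, abs_of_nonneg (sum_nonneg fun _ _ => abs_nonneg _)] at h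
    exact h
  set C := ∑ d ∈ range (D + 1), |c d| with hC
  have hC0 : 0 ≤ C := sum_nonneg fun _ _ => abs_nonneg _
  -- choose `X₀` with `D C / X₀ < ε / 2`
  obtain ⟨X₀, hX₀⟩ := exists_nat_gt (2 * (D + 1) * C / ε)
  refine ⟨max X₀ 1, fun X hX => ?_⟩
  have hX1 : (1 : ℝ) ≤ X := by exact_mod_cast le_of_max_le_right hX
  have hXpos : (0 : ℝ) < X := by linarith
  have hXX₀ : (X₀ : ℝ) ≤ X := by exact_mod_cast le_of_max_le_left hX
  rw [dist_zero_right, Real.norm_eq_abs, abs_of_nonneg (div_nonneg (sum_nonneg fun d _ =>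
    mul_nonneg (Nat.cast_nonneg d) (abs_nonneg _)) hXpos.le)]
  -- split the sum at `D`
  have hsplit : ∑ d ∈ Icc 1 X, (d : ℝ) * |c d| ≤ (D + 1) * C + X * (ε / 2) := by
    have hsub : Icc 1 X ⊆ range (D + 1) ∪ (Icc 1 X).filter (fun d => D < d) := by
      intro d hd
      by_cases h : d ≤ D
      · exact mem_union_left _ (mem_range.mpr (Nat.lt_succ_of_le h))
      · exact mem_union_right _ (mem_filter.mpr ⟨hd, not_le.mp h⟩)
    calc ∑ d ∈ Icc 1 X, (d : ℝ) * |c d|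
        ≤ ∑ d ∈ range (D + 1) ∪ (Icc 1 X).filter (fun d => D < d), (d : ℝ) * |c d| :=
          sum_le_sum_of_subset_of_nonneg hsub fun d _ _ => mul_nonneg (Nat.cast_nonneg d) (abs_nonneg _)
      _ = ∑ d ∈ range (D + 1), (d : ℝ) * |c d| + ∑ d ∈ (Icc 1 X).filter (fun d => D < d), (d : ℝ) * |c d| :=
          sum_union (Finset.disjoint_left.mpr fun d hd hd' => by
            have h1 := mem_range.mp hd; have h2 := (mem_filter.mp hd').2; omega)
      _ ≤ (D + 1) * C + X * (ε / 2) := add_le_add ?_ ?_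
    · rw [hC, mul_sum]
      refine sum_le_sum fun d hd => mul_le_mul_of_nonneg_right ?_ (abs_nonneg _)
      exact_mod_cast (mem_range.mp hd).le
    · calc ∑ d ∈ (Icc 1 X).filter (fun d => D < d), (d : ℝ) * |c d|
          ≤ ∑ d ∈ (Icc 1 X).filter (fun d => D < d), (X : ℝ) * |c d| := by
            refine sum_le_sum fun d hd => mul_le_mul_of_nonneg_right ?_ (abs_nonneg _)
            exact_mod_cast (mem_Icc.mp (mem_filter.mp hd).1).2
        _ = X * ∑ d ∈ (Icc 1 X).filter (fun d => D < d), |c d| := by rw [mul_sum]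
        _ ≤ X * (ε / 2) := mul_le_mul_of_nonneg_left ?_ hXpos.le
      exact (hD _ fun d hd => (mem_filter.mp hd).2).le
  have hlt : (D + 1) * C / X < ε / 2 := by
    rw [div_lt_iff₀ hXpos]
    have h := (div_lt_iff₀ hε).mp (hX₀.trans_le hXX₀)
    nlinarith [h, hC0]
  calc (∑ d ∈ Icc 1 X, (d : ℝ) * |c d|) / X ≤ ((D + 1) * C + X * (ε / 2)) / X :=
        div_le_div_of_nonneg_right hsplit hXpos.le
    _ = (D + 1) * C / X + ε / 2 := by field_simp
    _ < ε := by linarith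

end Kronecker

/-! ### `∑_{d ≤ X} g(d) T(X/d) / X² → ½ ∑ g(d)/d²` -/

section MainTerm

/-- `∑_{d ∈ Icc 1 X} f d = ∑_{d ∈ range (X+1)} f d` when `f 0 = 0`. [folklore] -/
theorem sum_Icc_one_eq_sum_range {f : ℕ → ℝ} (hf : f 0 = 0) (X : ℕ) :
    ∑ d ∈ Icc 1 X, f d = ∑ d ∈ range (X + 1), f d := by
  induction X with
  | zero => simp [hf]
  | succ X ih =>
    rw [Finset.sum_Icc_succ_top (Nat.succ_le_succ (Nat.zero_le X)), ih, Finset.sum_range_succ _ (X + 1)]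

/-- For `∑ |g d| / d² < ∞`:  `X⁻² ∑_{d ≤ X} g(d) (∑_{j ≤ X/d} j) → ½ ∑_d g(d)/d²`. [folklore] -/
theorem tendsto_sum_mul_triangular_div_sq {g : ℕ → ℝ} (hg : Summable fun d => |g d| / (d : ℝ) ^ 2) :
    Tendsto (fun X : ℕ => (∑ d ∈ Icc 1 X, g d * ∑ j ∈ Icc 1 (X / d), (j : ℝ)) / (X : ℝ) ^ 2) atTop
      (𝓝 ((1 / 2) * ∑' d, g d / (d : ℝ) ^ 2)) := by
  set c : ℕ → ℝ := fun d => g d / (d : ℝ) ^ 2 with hcdef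
  have hcabs : ∀ d, |c d| = |g d| / (d : ℝ) ^ 2 := fun d => by
    simp only [hcdef, abs_div, abs_pow, Nat.abs_cast]
  have hc : Summable fun d => |c d| := by simpa only [hcabs] using hg
  have hc' : Summable c := hc.of_abs
  -- main term
  have hmain : Tendsto (fun X : ℕ => (1 / 2) * ∑ d ∈ Icc 1 X, c d) atTop (𝓝 ((1 / 2) * ∑' d, c d)) := by
    refine Tendsto.const_mul _ ?_
    have h := hc'.hasSum.tendsto_sum_nat
    have h' := h.comp (tendsto_add_atTop_nat 1)
    refine h'.congr fun X => ?_
    simp only [Function.comp_apply]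
    exact (sum_Icc_one_eq_sum_range (by simp [hcdef]) X).symm
  -- error term
  have herr : Tendsto (fun X : ℕ => (∑ d ∈ Icc 1 X, g d * (∑ j ∈ Icc 1 (X / d), (j : ℝ) -
      ((X : ℝ) / d) ^ 2 / 2)) / (X : ℝ) ^ 2) atTop (𝓝 0) := by
    have hK := tendsto_sum_mul_div_atTop_zero hc
    refine squeeze_zero_norm' ?_ hK
    filter_upwards [eventually_gt_atTop 0] with X hX
    have hXpos : (0 : ℝ) < X := by exact_mod_cast hX
    rw [Real.norm_eq_abs, abs_div, abs_of_nonneg (sq_nonneg (X : ℝ)),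
      div_le_div_iff₀ (pow_pos hXpos 2) hXpos]
    calc |∑ d ∈ Icc 1 X, g d * (∑ j ∈ Icc 1 (X / d), (j : ℝ) - ((X : ℝ) / d) ^ 2 / 2)| * X
        ≤ (∑ d ∈ Icc 1 X, |g d| * ((X : ℝ) / d)) * X := by
          refine mul_le_mul_of_nonneg_right ((abs_sum_le_sum_abs _ _).trans (sum_le_sum fun d hd => ?_))
            hXpos.le
          rw [abs_mul]
          exact mul_le_mul_of_nonneg_left (abs_sum_Icc_div_sub_sq_le X d (mem_Icc.mp hd).1) (abs_nonneg _)
      _ = (∑ d ∈ Icc 1 X, (d : ℝ) * |c d|) * (X : ℝ) ^ 2 := by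
          rw [sq, ← mul_assoc, sum_mul, sum_mul, sum_mul]
          refine Finset.sum_congr rfl fun d hd => ?_
          have hd0 : (d : ℝ) ≠ 0 := by exact_mod_cast (Nat.pos_of_ne_zero (by have := (mem_Icc.mp hd).1; omega)).ne'
          rw [hcabs]
          field_simp
  -- combine
  have hsum : ∀ X : ℕ, (∑ d ∈ Icc 1 X, g d * ∑ j ∈ Icc 1 (X / d), (j : ℝ)) / (X : ℝ) ^ 2 =
      (1 / 2) * ∑ d ∈ Icc 1 X, c d + (∑ d ∈ Icc 1 X, g d * (∑ j ∈ Icc 1 (X / d), (j : ℝ) -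
        ((X : ℝ) / d) ^ 2 / 2)) / (X : ℝ) ^ 2 := by
    intro X
    by_cases hX : X = 0
    · subst hX; simp
    have hXpos : (0 : ℝ) < X := by exact_mod_cast Nat.pos_of_ne_zero hX
    have hX2 : (X : ℝ) ^ 2 ≠ 0 := pow_ne_zero 2 hXpos.ne'
    have key : ∀ d ∈ Icc 1 X, g d * ∑ j ∈ Icc 1 (X / d), (j : ℝ) =
        (X : ℝ) ^ 2 * ((1 / 2) * c d) + g d * (∑ j ∈ Icc 1 (X / d), (j : ℝ) - ((X : ℝ) / d) ^ 2 / 2) := by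
      intro d hd
      have hd0 : (d : ℝ) ≠ 0 := by exact_mod_cast (Nat.pos_of_ne_zero (by have := (mem_Icc.mp hd).1; omega)).ne'
      simp only [hcdef]
      field_simp
      ring
    rw [Finset.sum_congr rfl key, sum_add_distrib, ← mul_sum, ← mul_sum, add_div,
      mul_div_cancel_left₀ _ hX2]
  simp_rw [hsum]
  simpa using hmain.add herr

end MainTerm

/-! ### The Dirichlet factor `g = a * (μ · id)`: explicit values at prime powers -/

section Arithmetic

open ArithmeticFunction

variable (a : ℕ → ℕ)

/-- The arithmetic function `A` of `a` (value `0` at `0`). [folklore] -/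
def arithA : ArithmeticFunction ℝ := ⟨fun n => if n = 0 then 0 else (a n : ℝ), if_pos rfl⟩

/-- The arithmetic function `g` with `g(p^k) = a(p^k) - p a(p^{k-1})` (`k ≥ 1`), defined through the
factorisation (so that `a = g * id` when `a` is multiplicative with `a 1 = 1`). [folklore] -/
def arithG : ArithmeticFunction ℝ :=
  ⟨fun n => if n = 0 then 0 else n.factorization.prod fun p k => ((a (p ^ k) : ℝ) - p * a (p ^ (k - 1))),
    if_pos rfl⟩

variable {a}

omit a in
/-- Values of `arithA`. [folklore] -/
@[simp] theorem arithA_apply (a : ℕ → ℕ) {n : ℕ} (hn : n ≠ 0) : arithA a n = a n := if_neg hn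

/-- `arithA a` is multiplicative when `a` is. [folklore] -/
theorem isMultiplicative_arithA (ha1 : a 1 = 1) (hmul : ∀ m n, m.Coprime n → a (m * n) = a m * a n) :
    (arithA a).IsMultiplicative := by
  refine ⟨by simp [arithA, ha1], fun {m n} hmn => ?_⟩
  by_cases hm : m = 0
  · subst hm; simp [arithA]
  by_cases hn : n = 0
  · subst hn; simp [arithA]
  rw [arithA_apply a (mul_ne_zero hm hn), arithA_apply a hm, arithA_apply a hn, hmul m n hmn]
  push_cast; rfl

omit a in
/-- Values of `arithG` at prime powers: `g(p^k) = a(p^k) - p a(p^{k-1})` for `k ≥ 1`. [folklore] -/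
theorem arithG_apply_prime_pow (a : ℕ → ℕ) {p k : ℕ} (hp : p.Prime) (hk : k ≠ 0) :
    arithG a (p ^ k) = (a (p ^ k) : ℝ) - p * a (p ^ (k - 1)) := by
  simp only [arithG, ArithmeticFunction.coe_mk, pow_ne_zero k hp.ne_zero, if_false]
  rw [hp.factorization_pow, Finsupp.prod, Finsupp.support_single _ hk, Finset.prod_singleton,
    Finsupp.single_eq_same]

omit a in
/-- `g 1 = 1`. [folklore] -/
theorem arithG_one (a : ℕ → ℕ) : arithG a 1 = 1 := by simp [arithG]

/-- `arithG a` is multiplicative. [folklore] -/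
theorem isMultiplicative_arithG (a : ℕ → ℕ) : (arithG a).IsMultiplicative := by
  refine ⟨arithG_one a, fun {m n} hmn => ?_⟩
  by_cases hm : m = 0
  · subst hm; simp [arithG]
  by_cases hn : n = 0
  · subst hn; simp [arithG]
  simp only [arithG, ArithmeticFunction.coe_mk, mul_ne_zero hm hn, hm, hn, if_false]
  rw [Nat.factorization_mul_of_coprime hmn, Finsupp.prod_add_index_of_disjoint]
  rw [Nat.support_factorization, Nat.support_factorization]
  exact hmn.disjoint_primeFactors

/-- **`a = g * id`**: `a(n) = ∑_{d ∣ n} g(d) (n/d)` for multiplicative `a` with `a 1 = 1` (both sides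
are multiplicative and `∑_{i ≤ k} g(p^i) p^{k-i}` telescopes to `a(p^k)`). [folklore] -/
theorem arithG_mul_id_eq (ha1 : a 1 = 1) (hmul : ∀ m n, m.Coprime n → a (m * n) = a m * a n) :
    arithG a * ((ArithmeticFunction.id : ArithmeticFunction ℕ) : ArithmeticFunction ℝ) = arithA a := by
  have hG := isMultiplicative_arithG a
  have hI : (((ArithmeticFunction.id : ArithmeticFunction ℕ) : ArithmeticFunction ℝ)).IsMultiplicative :=
    isMultiplicative_id.natCast
  rw [ArithmeticFunction.IsMultiplicative.eq_iff_eq_on_prime_powers _ (hG.mul hI) _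
    (isMultiplicative_arithA ha1 hmul)]
  intro p k hp
  rw [arithA_apply a (pow_ne_zero k hp.ne_zero), ArithmeticFunction.mul_apply,
    Nat.sum_divisorsAntidiagonal fun x y => arithG a x * ((ArithmeticFunction.id : ArithmeticFunction ℕ) :
      ArithmeticFunction ℝ) y, Nat.sum_divisors_prime_pow hp]
  simp only [ArithmeticFunction.natCoe_apply, ArithmeticFunction.id_apply]
  -- `∑_{i ≤ k} g(p^i) · p^{k-i} = a(p^k)` by telescoping
  have hdiv : ∀ i ∈ range (k + 1), p ^ k / p ^ i = p ^ (k - i) := fun i hi =>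
    Nat.pow_div (Nat.lt_succ_iff.mp (mem_range.mp hi)) hp.pos
  rw [Finset.sum_congr rfl fun i hi => by rw [hdiv i hi]]
  induction k with
  | zero => simp [arithG_one, ha1]
  | succ k ih =>
    rw [Finset.sum_range_succ, arithG_apply_prime_pow a hp (by omega : k + 1 ≠ 0), Nat.add_sub_cancel,
      Nat.sub_self, pow_zero, Nat.cast_one, mul_one]
    have : ∑ i ∈ range (k + 1), arithG a (p ^ i) * ((p ^ (k + 1 - i) : ℕ) : ℝ) =
        (p : ℝ) * ∑ i ∈ range (k + 1), arithG a (p ^ i) * ((p ^ (k - i) : ℕ) : ℝ) := by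
      rw [mul_sum]
      refine Finset.sum_congr rfl fun i hi => ?_
      have hik : i ≤ k := Nat.lt_succ_iff.mp (mem_range.mp hi)
      rw [Nat.succ_sub hik, pow_succ]
      push_cast
      ring
    rw [this, ih (fun i hi => Nat.pow_div (Nat.lt_succ_iff.mp (mem_range.mp hi)) hp.pos)]
    ring

/-- **`∑_{n ≤ X} a(n) = ∑_{d ≤ X} g(d) · T(X/d)`** (`T(m) = ∑_{j ≤ m} j`; Dirichlet rearrangement,
Mathlib `ArithmeticFunction.sum_Ioc_mul_eq_sum_sum`). [folklore] -/
theorem sum_eq_sum_arithG_mul_triangular (ha1 : a 1 = 1)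
    (hmul : ∀ m n, m.Coprime n → a (m * n) = a m * a n) (X : ℕ) :
    ∑ n ∈ Icc 1 X, (a n : ℝ) = ∑ d ∈ Icc 1 X, arithG a d * ∑ j ∈ Icc 1 (X / d), (j : ℝ) := by
  have hIcc : ∀ m : ℕ, Icc 1 m = Ioc 0 m := fun m => by ext; simp; omega
  have h := ArithmeticFunction.sum_Ioc_mul_eq_sum_sum (arithG a)
    ((ArithmeticFunction.id : ArithmeticFunction ℕ) : ArithmeticFunction ℝ) X
  rw [arithG_mul_id_eq ha1 hmul] at h
  simp only [ArithmeticFunction.natCoe_apply, ArithmeticFunction.id_apply] at h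
  rw [hIcc, ← Finset.sum_congr rfl fun n hn => arithA_apply a (Nat.pos_of_ne_zero ?_).ne', h]
  · refine Finset.sum_congr rfl fun d _ => ?_
    rw [hIcc]
  · exact ((mem_Ioc.mp hn).1).ne'

end Arithmetic

/-! ### The Euler product `∑ g(d)/d² = ζ(2) ∏_{p ∈ S} (1 - p⁻²)(1 - p⁻¹) A_p` -/

section Euler

open ArithmeticFunction

variable {a : ℕ → ℕ}

omit a in
/-- A telescoping bound for the tail-free Euler product of `ζ(2)`:
`∏_{2 ≤ n ≤ M} (1 - n⁻²)⁻¹ = 2M/(M+1) ≤ 2`. [folklore] -/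
theorem prod_Icc_one_sub_inv_sq_inv_le_two (M : ℕ) :
    ∏ n ∈ Icc 2 M, (1 - ((n : ℝ) ^ 2)⁻¹)⁻¹ ≤ 2 := by
  have key : ∀ M : ℕ, 1 ≤ M → ∏ n ∈ Icc 2 M, (1 - ((n : ℝ) ^ 2)⁻¹)⁻¹ = 2 * M / (M + 1) := by
    intro M hM
    induction M with
    | zero => omega
    | succ M ih =>
      by_cases hM0 : M = 0
      · subst hM0; norm_num
      rw [Finset.prod_Icc_succ_top (by omega), ih (Nat.pos_of_ne_zero hM0)]
      have hM' : (0 : ℝ) < M := by exact_mod_cast Nat.pos_of_ne_zero hM0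
      have h1 : (M : ℝ) + 1 ≠ 0 := by positivity
      have h2 : (M : ℝ) + 1 + 1 ≠ 0 := by positivity
      have h3 : ((M : ℝ) + 1) ^ 2 ≠ 0 := by positivity
      have h4 : (M : ℝ) * 2 + (M : ℝ) ^ 2 ≠ 0 := ne_of_gt (by nlinarith)
      have h5 : ((M : ℝ) + 1) ^ 2 - 1 ≠ 0 := by nlinarith
      have key : (1 - (((M : ℝ) + 1) ^ 2)⁻¹)⁻¹ = ((M : ℝ) + 1) ^ 2 / ((M : ℝ) * (M + 2)) := by
        rw [inv_eq_one_div, inv_eq_one_div, one_sub_div h3, one_div_div]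
        congr 1; ring
      push_cast
      rw [key]
      field_simp
      ring
  by_cases hM : 1 ≤ M
  · rw [key M hM, div_le_iff₀ (by positivity)]; linarith
  · have : Icc 2 M = ∅ := Finset.Icc_eq_empty (by omega)
    rw [this, Finset.prod_empty]; norm_num

/-- `g(p^k) = 1` at a good prime power (`a(p^k) = σ₁(p^k)`). [folklore] -/
theorem arithG_apply_prime_pow_of_good {p : ℕ} (hp : p.Prime)
    (hgood : ∀ k, a (p ^ k) = ∑ i ∈ range (k + 1), p ^ i) {k : ℕ} (hk : k ≠ 0) :
    arithG a (p ^ k) = 1 := by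
  rw [arithG_apply_prime_pow a hp hk, hgood k, hgood (k - 1)]
  obtain ⟨k, rfl⟩ := Nat.exists_eq_succ_of_ne_zero hk
  rw [Nat.succ_sub_one, Finset.sum_range_succ']
  push_cast
  rw [Finset.mul_sum]
  simp only [pow_succ, pow_zero]
  ring_nf

/-- The local Euler factor at a bad prime: from `∑_k a(p^k) p^{-2k} = A_p` one gets
`∑_k g(p^k) p^{-2k} = (1 - p⁻¹) A_p`. [folklore] -/
theorem hasSum_arithG_prime_pow_div {p : ℕ} (hp : p.Prime) {Ap : ℝ}
    (hbad : HasSum (fun k => (a (p ^ k) : ℝ) / (p : ℝ) ^ (2 * k)) Ap) (ha1 : a 1 = 1) :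
    HasSum (fun k => arithG a (p ^ k) / (p : ℝ) ^ (2 * k)) ((1 - (p : ℝ)⁻¹) * Ap) := by
  have hp0 : (p : ℝ) ≠ 0 := by exact_mod_cast hp.ne_zero
  -- the shifted series `u k = p a(p^{k-1}) / p^{2k}` (`u 0 = 0`) sums to `Ap / p`
  set u : ℕ → ℝ := fun k => if k = 0 then 0 else (p : ℝ) * a (p ^ (k - 1)) / (p : ℝ) ^ (2 * k) with hu
  have hu' : HasSum u ((p : ℝ)⁻¹ * Ap) := by
    have h1 : HasSum (fun k => u (k + 1)) ((p : ℝ)⁻¹ * Ap) := by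
      have := hbad.mul_left ((p : ℝ)⁻¹)
      refine this.congr_fun fun k => ?_
      simp only [hu, Nat.add_sub_cancel, if_neg (Nat.succ_ne_zero k)]
      rw [show 2 * (k + 1) = 2 * k + 2 by ring, pow_add]
      field_simp
    have h0 : ∑ i ∈ range 1, u i = 0 := by simp [hu]
    have := (hasSum_nat_add_iff (f := u) 1).mp h1
    rwa [h0, add_zero] at this
  have hsub := hbad.sub hu'
  have hv : Ap - (p : ℝ)⁻¹ * Ap = (1 - (p : ℝ)⁻¹) * Ap := by ring
  rw [hv] at hsub
  refine hsub.congr_fun fun k => ?_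
  by_cases hk : k = 0
  · subst hk; simp [hu, arithG_one, ha1]
  · simp only [hu, hk, if_false, arithG_apply_prime_pow a hp hk]
    ring

/-- The local Euler factor at a good prime: `∑_k g(p^k) p^{-2k} = (1 - p⁻²)⁻¹`. [folklore] -/
theorem hasSum_arithG_prime_pow_div_of_good {p : ℕ} (hp : p.Prime)
    (hgood : ∀ k, a (p ^ k) = ∑ i ∈ range (k + 1), p ^ i) :
    HasSum (fun k => arithG a (p ^ k) / (p : ℝ) ^ (2 * k)) (1 - ((p : ℝ) ^ 2)⁻¹)⁻¹ := by
  have hp1 : (1 : ℝ) < p := by exact_mod_cast hp.one_lt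
  have hr0 : (0 : ℝ) ≤ ((p : ℝ) ^ 2)⁻¹ := by positivity
  have hr1 : ((p : ℝ) ^ 2)⁻¹ < 1 := inv_lt_one_of_one_lt₀ (by nlinarith)
  refine (hasSum_geometric_of_lt_one hr0 hr1).congr_fun fun k => ?_
  by_cases hk : k = 0
  · subst hk; simp [arithG_one]
  · rw [arithG_apply_prime_pow_of_good hp hgood hk, pow_mul, inv_pow, one_div]

/-- The function `n ↦ g(n)/n²` is multiplicative on coprime arguments. [folklore] -/
theorem arithG_div_sq_mul_of_coprime (a : ℕ → ℕ) {m n : ℕ} (hmn : m.Coprime n) :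
    arithG a (m * n) / ((m * n : ℕ) : ℝ) ^ 2 = arithG a m / (m : ℝ) ^ 2 * (arithG a n / (n : ℝ) ^ 2) := by
  rw [(isMultiplicative_arithG a).map_mul_of_coprime hmn]
  push_cast
  rw [mul_pow, div_mul_div_comm]

/-- **Summability and the Euler product for `∑ g(d)/d²`**: if `a` is multiplicative with
`a(p^k) = σ₁(p^k)` at the primes outside `S` and `∑_k a(p^k) p^{-2k} = A_p` converges for `p ∈ S`,
then `∑ |g(d)|/d² < ∞` and `∑ g(d)/d² = ζ(2) ∏_{p ∈ S} (1 - p⁻²)(1 - p⁻¹) A_p`, `ζ(2) = π²/6`.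
[folklore] -/
theorem summable_and_tsum_arithG_div_sq (ha1 : a 1 = 1) (S : Finset ℕ) (hS : ∀ p ∈ S, p.Prime)
    (hgood : ∀ p, p.Prime → p ∉ S → ∀ k, a (p ^ k) = ∑ i ∈ range (k + 1), p ^ i)
    (A : ℕ → ℝ) (hbad : ∀ p ∈ S, HasSum (fun k => (a (p ^ k) : ℝ) / (p : ℝ) ^ (2 * k)) (A p)) :
    Summable (fun n => |arithG a n| / (n : ℝ) ^ 2) ∧
      ∑' n, arithG a n / (n : ℝ) ^ 2 =
        π ^ 2 / 6 * ∏ p ∈ S, ((1 - ((p : ℝ) ^ 2)⁻¹) * (1 - (p : ℝ)⁻¹) * A p) := by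
  classical
  set f : ℕ → ℝ := fun n => arithG a n / (n : ℝ) ^ 2 with hfdef
  have hf₁ : f 1 = 1 := by simp [hfdef, arithG_one]
  have hf₀ : f 0 = 0 := by simp [hfdef]
  have hfmul : ∀ {m n : ℕ}, m.Coprime n → f (m * n) = f m * f n := fun hmn =>
    arithG_div_sq_mul_of_coprime a hmn
  have hnorm : ∀ n, ‖f n‖ = |arithG a n| / (n : ℝ) ^ 2 := fun n => by
    rw [Real.norm_eq_abs, hfdef]; dsimp only; rw [abs_div, abs_pow, Nat.abs_cast]
  have hfpow : ∀ p k : ℕ, f (p ^ k) = arithG a (p ^ k) / (p : ℝ) ^ (2 * k) := fun p k => by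
    simp only [hfdef, Nat.cast_pow, ← pow_mul, mul_comm k 2]
  -- local factors `V p = ∑' k, ‖f (p^k)‖` and `L p = ∑' k, f (p ^ k)`
  have hlocS : ∀ p ∈ S, HasSum (fun k => f (p ^ k)) ((1 - (p : ℝ)⁻¹) * A p) := fun p hp => by
    simpa only [hfpow] using hasSum_arithG_prime_pow_div (hS p hp) (hbad p hp) ha1
  have hlocG : ∀ p, p.Prime → p ∉ S → HasSum (fun k => f (p ^ k)) (1 - ((p : ℝ) ^ 2)⁻¹)⁻¹ :=
    fun p hp hpS => by simpa only [hfpow] using hasSum_arithG_prime_pow_div_of_good hp (hgood p hp hpS)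
  -- summability of the local norm series
  have hlocnorm : ∀ {p : ℕ}, p.Prime → Summable (fun k => ‖f (p ^ k)‖) := by
    intro p hp
    by_cases hpS : p ∈ S
    · -- `|g(p^k)| / p^{2k} ≤ (a(p^k) + p a(p^{k-1})) / p^{2k}`
      have hp0 : (0 : ℝ) < p := by exact_mod_cast hp.pos
      have h1 : Summable (fun k => (a (p ^ k) : ℝ) / (p : ℝ) ^ (2 * k)) := (hbad p hpS).summable
      have h2 : Summable (fun k => (p : ℝ) * a (p ^ (k - 1)) / (p : ℝ) ^ (2 * k)) := by
        have h2' : Summable (fun k => (p : ℝ) * a (p ^ k) / (p : ℝ) ^ (2 * (k + 1))) := by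
          have := (h1.mul_left ((p : ℝ)⁻¹))
          refine this.congr fun k => ?_
          rw [show 2 * (k + 1) = 2 * k + 2 by ring, pow_add]
          field_simp
        rw [← summable_nat_add_iff 1]
        refine h2'.congr fun k => ?_
        simp only [Nat.add_sub_cancel]
      refine Summable.of_nonneg_of_le (fun k => norm_nonneg _) (fun k => ?_) (h1.add h2)
      rw [hnorm, Nat.cast_pow, ← pow_mul, mul_comm k 2]
      by_cases hk : k = 0
      · subst hk
        simp only [pow_zero, mul_zero, Nat.zero_sub, div_one, arithG_one, abs_one, ha1, Nat.cast_one,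
          mul_one]
        linarith
      rw [arithG_apply_prime_pow a hp hk, ← add_div]
      refine div_le_div_of_nonneg_right ?_ (by positivity)
      exact (abs_sub _ _).trans (by rw [abs_of_nonneg (by positivity), abs_of_nonneg (by positivity)])
    · -- good prime: the norms are the (non-negative) terms themselves
      refine (hlocG p hp hpS).summable.congr fun k => ?_
      rw [Real.norm_of_nonneg]
      rw [hfpow]
      by_cases hk : k = 0
      · subst hk; simp [arithG_one]
      · rw [arithG_apply_prime_pow_of_good hp (hgood p hp hpS) hk]; positivity
  have hVgood : ∀ p, p.Prime → p ∉ S → ∑' k, ‖f (p ^ k)‖ = (1 - ((p : ℝ) ^ 2)⁻¹)⁻¹ := by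
    intro p hp hpS
    rw [← (hlocG p hp hpS).tsum_eq]
    refine tsum_congr fun k => ?_
    rw [Real.norm_of_nonneg]
    rw [hfpow]
    by_cases hk : k = 0
    · subst hk; simp [arithG_one]
    · rw [arithG_apply_prime_pow_of_good hp (hgood p hp hpS) hk]; positivity
  -- bounded partial sums of `‖f‖`, hence summability
  have hsumm : Summable (fun n => ‖f n‖) := by
    have hn1 : ‖f 1‖ = 1 := by rw [hf₁, norm_one]
    have hnmul : ∀ {m n : ℕ}, m.Coprime n → ‖f (m * n)‖ = ‖f m‖ * ‖f n‖ := fun h => by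
      rw [hfmul h, norm_mul]
    set C : ℝ := (∏ p ∈ S, max 1 (∑' k, ‖f (p ^ k)‖)) * 2 with hCdef
    refine summable_of_sum_range_le (fun n => norm_nonneg _) (c := C) fun N => ?_
    obtain ⟨-, hhs⟩ := EulerProduct.summable_and_hasSum_factoredNumbers_prod_filter_prime_tsum
      (f := fun n => ‖f n‖) hn1 hnmul (fun hp => by simpa only [norm_norm] using hlocnorm hp) (range N)
    -- every `0 < n < N` is `(range N)`-factored
    have hle : ∑ n ∈ range N, ‖f n‖ ≤ ∏ p ∈ (range N).filter Nat.Prime, ∑' k, ‖f (p ^ k)‖ := by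
      have hsub : ∀ n ∈ (range N).filter (· ≠ 0), n ∈ Nat.factoredNumbers (range N) := fun n hn => by
        obtain ⟨hnN, hn0⟩ := mem_filter.mp hn
        refine Nat.mem_factoredNumbers.mpr ⟨hn0, fun q hq => mem_range.mpr ?_⟩
        exact (Nat.le_of_mem_primeFactorsList hq).trans_lt (mem_range.mp hnN)
      have h0 : ∑ n ∈ range N, ‖f n‖ = ∑ n ∈ (range N).filter (· ≠ 0), ‖f n‖ := by
        rw [Finset.sum_filter_of_ne]
        rintro n - hn rfl
        exact hn (by rw [hf₀, norm_zero])
      -- rewrite as a sum over the subtype and compare with the `HasSum`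
      let T : Finset (Nat.factoredNumbers (range N)) :=
        ((range N).filter (· ≠ 0)).subtype (· ∈ Nat.factoredNumbers (range N))
      have hT : ∑ m ∈ T, ‖f (m : ℕ)‖ = ∑ n ∈ (range N).filter (· ≠ 0), ‖f n‖ := by
        simp only [T]
        rw [Finset.sum_subtype_eq_sum_filter (f := fun n => ‖f n‖), Finset.filter_true_of_mem hsub]
      rw [h0, ← hT]
      exact sum_le_hasSum T (fun m _ => norm_nonneg _) hhs
    refine hle.trans ?_
    -- split the finite Euler product into the primes of `S` and the good primes
    rw [← Finset.prod_filter_mul_prod_filter_not ((range N).filter Nat.Prime) (· ∈ S)]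
    refine mul_le_mul ?_ ?_ (Finset.prod_nonneg fun p _ => tsum_nonneg fun k => norm_nonneg _)
      ((Finset.prod_nonneg fun p _ => le_trans zero_le_one (le_max_left _ _)))
    · -- bad primes: bounded by the full product over `S` of `max 1 V_p`
      calc ∏ p ∈ ((range N).filter Nat.Prime).filter (· ∈ S), ∑' k, ‖f (p ^ k)‖
          ≤ ∏ p ∈ ((range N).filter Nat.Prime).filter (· ∈ S), max 1 (∑' k, ‖f (p ^ k)‖) :=
            Finset.prod_le_prod (fun p _ => tsum_nonneg fun k => norm_nonneg _) fun p _ => le_max_right _ _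
        _ ≤ ∏ p ∈ S, max 1 (∑' k, ‖f (p ^ k)‖) :=
            Finset.prod_le_prod_of_subset_of_one_le (fun p hp => (mem_filter.mp hp).2)
              (fun p _ => le_trans zero_le_one (le_max_left _ _)) fun p _ _ => le_max_left _ _
    · -- good primes: `∏ (1 - p⁻²)⁻¹ ≤ ∏_{2 ≤ n ≤ N} (1 - n⁻²)⁻¹ ≤ 2`
      have heq : ∀ p ∈ ((range N).filter Nat.Prime).filter (fun p => p ∉ S),
          ∑' k, ‖f (p ^ k)‖ = (1 - ((p : ℝ) ^ 2)⁻¹)⁻¹ := fun p hp => by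
        obtain ⟨hp1, hp2⟩ := mem_filter.mp hp
        exact hVgood p (mem_filter.mp hp1).2 hp2
      rw [Finset.prod_congr rfl heq]
      refine le_trans ?_ (prod_Icc_one_sub_inv_sq_inv_le_two N)
      have hge1 : ∀ n : ℕ, 2 ≤ n → (1 : ℝ) ≤ (1 - ((n : ℝ) ^ 2)⁻¹)⁻¹ := fun n hn => by
        have hn2 : (2 : ℝ) ≤ n := by exact_mod_cast hn
        have h4 : (4 : ℝ) ≤ (n : ℝ) ^ 2 := by nlinarith
        rw [one_le_inv_iff₀]
        constructor
        · rw [sub_pos]; exact inv_lt_one_of_one_lt₀ (by linarith)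
        · rw [sub_le_self_iff]; positivity
      refine Finset.prod_le_prod_of_subset_of_one_le (fun p hp => ?_) (fun p hp => ?_) (fun n hn _ => ?_)
      · obtain ⟨hp1, -⟩ := mem_filter.mp hp
        obtain ⟨hpN, hpp⟩ := mem_filter.mp hp1
        exact mem_Icc.mpr ⟨hpp.two_le, (mem_range.mp hpN).le⟩
      · obtain ⟨hp1, -⟩ := mem_filter.mp hp
        exact le_trans zero_le_one (hge1 p (mem_filter.mp hp1).2.two_le)
      · exact hge1 n (mem_Icc.mp hn).1
  refine ⟨by simpa only [hnorm] using hsumm, ?_⟩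
  -- the Euler product
  have hEuler := EulerProduct.eulerProduct_hasProd hf₁ hfmul hsumm hf₀
  -- `ζ(2) = ∏ (1 - p⁻²)⁻¹ = π² / 6`
  let f₀ : ℕ →*₀ ℝ :=
    { toFun := fun n => ((n : ℝ) ^ 2)⁻¹
      map_zero' := by simp
      map_one' := by simp
      map_mul' := fun m n => by push_cast; rw [mul_pow, mul_inv] }
  have hf₀sum : Summable (fun n => ‖f₀ n‖) := by
    have h := Real.summable_nat_pow_inv.mpr (by norm_num : 1 < 2)
    refine h.congr fun n => ?_
    change ((n : ℝ) ^ 2)⁻¹ = ‖((n : ℝ) ^ 2)⁻¹‖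
    rw [Real.norm_of_nonneg (by positivity)]
  have hζ : HasProd (fun p : Nat.Primes => (1 - ((p : ℝ) ^ 2)⁻¹)⁻¹) (π ^ 2 / 6) := by
    have h := EulerProduct.eulerProduct_completely_multiplicative_hasProd hf₀sum
    have hval : ∑' n, f₀ n = π ^ 2 / 6 := by
      rw [← hasSum_zeta_two.tsum_eq]
      exact tsum_congr fun n => by change ((n : ℝ) ^ 2)⁻¹ = 1 / (n : ℝ) ^ 2; rw [one_div]
    rw [hval] at h
    exact h
  -- the finite correction at the primes of `S`
  let g : ℕ → ℝ := fun p => if p ∈ S then (1 - ((p : ℝ) ^ 2)⁻¹) * (1 - (p : ℝ)⁻¹) * A p else 1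
  let M : Nat.Primes → ℝ := fun p => g p
  set S' : Finset Nat.Primes := S.preimage (fun p : Nat.Primes => (p : ℕ))
    Nat.Primes.coe_nat_injective.injOn with hS'
  have hM : HasProd M (∏ p ∈ S', M p) :=
    hasProd_prod_of_ne_finset_one fun p hp => by
      simp only [M, g]
      rw [if_neg]
      rwa [hS', Finset.mem_preimage] at hp
  have hprod := hζ.mul hM
  -- the local factors of `f` are `(1 - p⁻²)⁻¹ · M p`
  have hL : ∀ p : Nat.Primes, ∑' e, f (p ^ e) = (1 - ((p : ℝ) ^ 2)⁻¹)⁻¹ * M p := by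
    intro p
    have hpp : (p : ℕ).Prime := p.2
    by_cases hpS : (p : ℕ) ∈ S
    · rw [(hlocS p hpS).tsum_eq]
      simp only [M, g, if_pos hpS]
      have hne : (1 - ((p : ℝ) ^ 2)⁻¹) ≠ 0 := by
        have : (1 : ℝ) < (p : ℝ) ^ 2 := by
          have h2 : (2 : ℝ) ≤ p := by exact_mod_cast hpp.two_le
          nlinarith
        rw [sub_ne_zero]; exact (inv_lt_one_of_one_lt₀ this).ne'
      rw [← mul_assoc, ← mul_assoc, inv_mul_cancel₀ hne, one_mul]
    · rw [(hlocG p hpp hpS).tsum_eq]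
      simp only [M, g, if_neg hpS, mul_one]
  have hEuler' : HasProd (fun p : Nat.Primes => (1 - ((p : ℝ) ^ 2)⁻¹)⁻¹ * M p) (∑' n, f n) := by
    refine hEuler.congr_fun fun p => ?_
    exact (hL p).symm
  have hval : ∑' n, f n = π ^ 2 / 6 * ∏ p ∈ S', M p := hEuler'.unique hprod
  change tsum f = _
  rw [hval]
  congr 1
  simp only [M, hS']
  rw [Finset.prod_preimage (fun p : Nat.Primes => (p : ℕ)) S Nat.Primes.coe_nat_injective.injOn g
    (fun p hp hpr => absurd ⟨⟨p, hS p hp⟩, rfl⟩ hpr)]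
  exact Finset.prod_congr rfl fun p hp => if_pos hp

end Euler

/-! ### The mean value -/

section MeanValue

/-- **Mean value of a multiplicative function which is `σ₁` at almost all primes.** Let
`a : ℕ → ℕ` be multiplicative (`a 1 = 1`, `a(mn) = a(m) a(n)` for coprime `m, n`), let `S` be a
finite set of primes such that `a(p^k) = 1 + p + ⋯ + p^k` for every prime `p ∉ S`, and suppose
`∑_k a(p^k) p^{-2k} = A_p` converges for `p ∈ S`. Then

  `(1/X²) ∑_{n ≤ X} a(n) ⟶ (π²/12) ∏_{p ∈ S} (1 - p⁻²)(1 - p⁻¹) A_p`   (`X → ∞`).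

This is the Tauberian-free form of the residue computation for Dirichlet series
`∑ a(n) n^{-s} = ζ(s) ζ(s-1) ∏_{p ∈ S} (⋯)` used for Eichler's zeta function of a quaternion order
(Voight, *Quaternion Algebras*, (25.3.7), Cor. 26.4.11: `res_{s=1} ζ_B(s) = ζ(2)/2 ∏_{p ∣ D}(1 - p⁻¹)`);
here by `a = g * id`, `∑_{n ≤ X} a(n) = ∑_{d ≤ X} g(d) T(X/d)`, `T(y) = y²/2 + O(y)`, the absolute
convergence of `∑ g(d)/d²` and its Euler product. [folklore] -/
theorem tendsto_sum_div_sq_of_multiplicative (a : ℕ → ℕ) (ha1 : a 1 = 1)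
    (hmul : ∀ m n, m.Coprime n → a (m * n) = a m * a n) (S : Finset ℕ) (hS : ∀ p ∈ S, p.Prime)
    (hgood : ∀ p, p.Prime → p ∉ S → ∀ k, a (p ^ k) = ∑ i ∈ range (k + 1), p ^ i)
    (A : ℕ → ℝ) (hbad : ∀ p ∈ S, HasSum (fun k => (a (p ^ k) : ℝ) / (p : ℝ) ^ (2 * k)) (A p)) :
    Tendsto (fun X : ℕ => (∑ n ∈ Icc 1 X, (a n : ℝ)) / (X : ℝ) ^ 2) atTop
      (𝓝 (π ^ 2 / 12 * ∏ p ∈ S, ((1 - ((p : ℝ) ^ 2)⁻¹) * (1 - (p : ℝ)⁻¹) * A p))) := by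
  obtain ⟨hsum, hval⟩ := summable_and_tsum_arithG_div_sq ha1 S hS hgood A hbad
  have h := tendsto_sum_mul_triangular_div_sq hsum
  rw [hval] at h
  have hlim : (1 / 2 : ℝ) * (π ^ 2 / 6 * ∏ p ∈ S, ((1 - ((p : ℝ) ^ 2)⁻¹) * (1 - (p : ℝ)⁻¹) * A p)) =
      π ^ 2 / 12 * ∏ p ∈ S, ((1 - ((p : ℝ) ^ 2)⁻¹) * (1 - (p : ℝ)⁻¹) * A p) := by ring
  rw [hlim] at h
  refine h.congr fun X => ?_
  rw [sum_eq_sum_arithG_mul_triangular ha1 hmul X]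

end MeanValue

end Literature.NumberTheory.Automorphic
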